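import Literature.Computability.Cryptography.RegevReductionLemma32Sampler
import Literature.Computability.Cryptography.RegevBootstrap
import Literature.Computability.Complexity.CodeFPRat
import Literature.Computability.Complexity.CodeFPOfUnary
import HarnessLib

/-!
# Regev 2009, Lemma 3.3 in machine form: the rational step ratio costs `n/2ⁿ`

The residual `regev2009_lemma_3_3_stepMachine q α` (A_step, `RegevReductionStageResiduals.lean`)
asks the iterative step for a poly-time computable RATIONAL ratio `θ(n) ≥ α q/√n` and, at a stage
`k + 1 ≤ 3n` with input radius `ρ_k = θ^{3n-k} r`, for output `F₁(b)`-close to `D_{L,ρ_{k+1}}`,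
`ρ_{k+1} = ρ_k/θ`. Regev's Lemma 3.3 (arXiv:2401.03703, p. 15: Lemma 3.4 solves `CVP_{L*, αp/(√2 ρ_k)}`,
Lemma 3.14 turns a `CVP_{L*,d}` oracle into a `D_{L,√n/(√2 d)}` sampler) produces `D_{L, ρ_k√n/(αq)}`
— ratio EXACTLY `αq/√n`, irrational for non-square `n` — and no smaller radius (a larger decoding
distance `d` is out of reach of Lemma 3.7). A referee (bundle `lwe-quantum-autopsy`, finding F-5.1)
therefore asked whether A_step demands a contraction strictly stronger than Lemma 3.3 provides.

This file answers: NO, up to a negligible statistical error that A_step's approximate clause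
(STEP₁: per-batch error `F₁`, `E[min 1 F₁] ≤ ν₁` negligible) absorbs, and with no `CVP` instance beyond
Lemma 3.4's distance ever solved.
* `Regev2009.stepRatio a q n = |a n|·q n·invSqrtUp n` with `invSqrtUp n = 2ⁿ/⌊2ⁿ√n⌋ ∈ [1/√n, (1 + 2⁻ⁿ)/√n]`
  is a poly-time computable rational (`stepRatio_codeFP`, from the tree's `CodeFP` arithmetic) with
  `α q/√n ≤ θ(n) ≤ (α q/√n)(1 + 2⁻ⁿ)` (`le_stepRatio`, `stepRatio_le`); packaged from
  `IsPolyTimeParams q α m` as `exists_polyTime_stepRatio` — exactly the `∃ θ` A_step asks for.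
* `tvDist_map_intCoords_discreteGaussian_div_le`: `Δ(D_{L,R/θ₀}, D_{L,R/θ}) ≤ n(1 - θ₀/θ)` for
  `0 < θ₀ ≤ θ` (the tree's width-continuity bound `tvDist_discreteGaussian_le_mul_one_sub_div`).
* `tvDist_regevStep_levelRadius_le`: with `θ = stepRatio`, at every stage `k < 3n`, Regev's EXACT
  step output `D_{L, ρ_k√n/(αq)}` is within `n/2ⁿ` of A_step's target `D_{L, ρ_{k+1}}` (read in
  integer coordinates) — so a machine implementing Lemma 3.3 at decoding distance `αq/(√2ρ_k)` meets
  STEP₁ with `F₁ + n/2ⁿ` in place of `F₁`, `ν₁ + n/2ⁿ` in place of `ν₁` (`tsum_mul_min_one_add_le`).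
* `regev2009_lemma_3_3_stepExact q α` (NAMED FACT A_exact): A_step word for word but with the ladder
  FIXED to `stepRatio` and STEP₁'s target the EXACT Lemma-3.3 law `D_{L, ρ_k√n/(αq)}`;
  `regev2009_lemma_3_3_stepMachine_of_exact : A_exact → A_step`, whence
  `regev_lwe_to_sivp_quantum_holds_of_exact` / `regev_lwe_to_gapSVP_quantum_holds_of_exact`: both forms
  of Regev's Theorem 1.1 from A_exact ALONE (A_boot being the theorem `regev2009_lemma_3_2_sampler_holds`).

VALUE. A precise certificate about the TYPING of a residual (trust-base labelling: A_step is implied by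
the verbatim machine form of Lemma 3.3), not progress on any open problem and not a proof of A_step /
A_exact, which remains the one named residual of the tree's formalisation of Regev's Theorem 1.1.
-/

open Filter _root_.Computability Literature.Computability.Complexity Literature.Computability.Complexity.CodeFP
  Literature.Algebra.EuclideanLattices Literature.Computability.QuantumComplexity
  Literature.Computability.Cryptography.LWE
open scoped Real

namespace Literature.Computability.Cryptography

namespace Regev2009

/-! ### An upper rational approximation of `1/√n` -/

/-- `invSqrtUp n = 2ⁿ / ⌊√(n·4ⁿ)⌋ = 2ⁿ/⌊2ⁿ√n⌋`, an upper rational approximation of `1/√n` to relative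
precision `2⁻ⁿ` (`n ≥ 1`; junk `0` at `n = 0`). [folklore] -/
def invSqrtUp (n : ℕ) : ℚ :=
  (((2 ^ n : ℕ) : ℤ) : ℚ) / ((Nat.sqrt (n * (2 ^ n * 2 ^ n)) : ℕ) : ℚ)

/-- `⌊2ⁿ√n⌋ ≥ 2ⁿ` for `n ≥ 1`. [folklore] -/
theorem two_pow_le_sqrt {n : ℕ} (hn : 0 < n) : 2 ^ n ≤ Nat.sqrt (n * (2 ^ n * 2 ^ n)) := by
  calc 2 ^ n = Nat.sqrt (2 ^ n * 2 ^ n) := (Nat.sqrt_eq _).symm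
    _ ≤ Nat.sqrt (n * (2 ^ n * 2 ^ n)) := Nat.sqrt_le_sqrt (Nat.le_mul_of_pos_left _ hn)

/-- `⌊2ⁿ√n⌋ ≤ 2ⁿ√n`. [folklore] -/
theorem sqrt_le_two_pow_mul_sqrt (n : ℕ) :
    ((Nat.sqrt (n * (2 ^ n * 2 ^ n)) : ℕ) : ℝ) ≤ (2 : ℝ) ^ n * Real.sqrt n := by
  have h := Nat.sqrt_le' (n * (2 ^ n * 2 ^ n))
  have h' : ((Nat.sqrt (n * (2 ^ n * 2 ^ n)) : ℕ) : ℝ) ^ 2 ≤ (n : ℝ) * ((2 : ℝ) ^ n * (2 : ℝ) ^ n) := by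
    exact_mod_cast h
  have heq : (2 : ℝ) ^ n * Real.sqrt n = Real.sqrt ((n : ℝ) * ((2 : ℝ) ^ n * (2 : ℝ) ^ n)) := by
    rw [show (n : ℝ) * ((2 : ℝ) ^ n * (2 : ℝ) ^ n) = ((2 : ℝ) ^ n) ^ 2 * n by ring,
      Real.sqrt_mul (by positivity), Real.sqrt_sq (by positivity)]
  rw [heq]
  exact Real.le_sqrt_of_sq_le h'

/-- `2ⁿ√n < ⌊2ⁿ√n⌋ + 1`. [folklore] -/
theorem two_pow_mul_sqrt_lt_sqrt_add_one (n : ℕ) :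
    (2 : ℝ) ^ n * Real.sqrt n < ((Nat.sqrt (n * (2 ^ n * 2 ^ n)) : ℕ) : ℝ) + 1 := by
  have h := Nat.lt_succ_sqrt' (n * (2 ^ n * 2 ^ n))
  have h' : (n : ℝ) * ((2 : ℝ) ^ n * (2 : ℝ) ^ n) < (((Nat.sqrt (n * (2 ^ n * 2 ^ n)) : ℕ) : ℝ) + 1) ^ 2 := by
    exact_mod_cast h
  have heq : (2 : ℝ) ^ n * Real.sqrt n = Real.sqrt ((n : ℝ) * ((2 : ℝ) ^ n * (2 : ℝ) ^ n)) := by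
    rw [show (n : ℝ) * ((2 : ℝ) ^ n * (2 : ℝ) ^ n) = ((2 : ℝ) ^ n) ^ 2 * n by ring,
      Real.sqrt_mul (by positivity), Real.sqrt_sq (by positivity)]
  rw [heq]
  exact (Real.sqrt_lt' (by positivity)).2 h'

/-- The cast of `invSqrtUp`. [folklore] -/
theorem invSqrtUp_cast (n : ℕ) :
    ((invSqrtUp n : ℚ) : ℝ) = (2 : ℝ) ^ n / ((Nat.sqrt (n * (2 ^ n * 2 ^ n)) : ℕ) : ℝ) := by
  simp [invSqrtUp]

/-- **Lower bound**: `1/√n ≤ invSqrtUp n` (`n ≥ 1`). [folklore] -/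
theorem one_div_sqrt_le_invSqrtUp {n : ℕ} (hn : 0 < n) : 1 / Real.sqrt n ≤ ((invSqrtUp n : ℚ) : ℝ) := by
  rw [invSqrtUp_cast]
  have hT : (0 : ℝ) < ((Nat.sqrt (n * (2 ^ n * 2 ^ n)) : ℕ) : ℝ) := by
    have := two_pow_le_sqrt hn
    have h2 : 0 < 2 ^ n := by positivity
    exact_mod_cast lt_of_lt_of_le h2 this
  have hs : 0 < Real.sqrt n := Real.sqrt_pos.2 (by exact_mod_cast hn)
  rw [div_le_div_iff₀ hs hT, one_mul]
  exact sqrt_le_two_pow_mul_sqrt n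

/-- **Upper bound**: `invSqrtUp n ≤ (1/√n)(1 + 2⁻ⁿ)` (`n ≥ 1`). [folklore] -/
theorem invSqrtUp_le {n : ℕ} (hn : 0 < n) :
    ((invSqrtUp n : ℚ) : ℝ) ≤ 1 / Real.sqrt n * (1 + 1 / (2 : ℝ) ^ n) := by
  rw [invSqrtUp_cast]
  set T : ℝ := ((Nat.sqrt (n * (2 ^ n * 2 ^ n)) : ℕ) : ℝ) with hT_def
  have hK : (0 : ℝ) < (2 : ℝ) ^ n := by positivity
  have hKT : (2 : ℝ) ^ n ≤ T := by rw [hT_def]; exact_mod_cast two_pow_le_sqrt hn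
  have hT : 0 < T := hK.trans_le hKT
  have hs : 0 < Real.sqrt n := Real.sqrt_pos.2 (by exact_mod_cast hn)
  have hlt : (2 : ℝ) ^ n * Real.sqrt n < T + 1 := two_pow_mul_sqrt_lt_sqrt_add_one n
  have key : (2 : ℝ) ^ n * Real.sqrt n ≤ T * (1 + 1 / (2 : ℝ) ^ n) := by
    have h1 : 1 ≤ T / (2 : ℝ) ^ n := by rw [le_div_iff₀ hK, one_mul]; exact hKT
    have h2 : T * (1 + 1 / (2 : ℝ) ^ n) = T + T / (2 : ℝ) ^ n := by ring
    rw [h2]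
    linarith
  calc (2 : ℝ) ^ n / T = (2 : ℝ) ^ n * Real.sqrt n / (T * Real.sqrt n) := (mul_div_mul_right _ _ hs.ne').symm
    _ ≤ T * (1 + 1 / (2 : ℝ) ^ n) / (T * Real.sqrt n) := div_le_div_of_nonneg_right key (by positivity)
    _ = (1 + 1 / (2 : ℝ) ^ n) / Real.sqrt n := mul_div_mul_left _ _ hT.ne'
    _ = 1 / Real.sqrt n * (1 + 1 / (2 : ℝ) ^ n) := by ring

/-- `invSqrtUp` is computed on codes (unary `n` ↦ reduced fraction). [cite: AroraBarak2009, §1.3] -/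
theorem invSqrtUp_codeFP : CodeFP unE encodeRat invSqrtUp := by
  have hK : CodeFP unE natE (fun n : ℕ => 2 ^ n) := (natPow.comp ((const unE (2 : ℕ)).pair (CodeFP.id unE)) :)
  have hT : CodeFP unE natE (fun n : ℕ => Nat.sqrt (n * (2 ^ n * 2 ^ n))) :=
    (natSqrt.comp (natMul.comp (natOfUn.pair (natMul.comp (hK.pair hK)))) :)
  exact (ratOfIntNat.comp ((intOfNat.comp hK).pair hT) :)

/-! ### The step ratio -/

/-- **The rational step ratio** `θ(n) = |a n|·q n·invSqrtUp n` for a rational noise rate `a` and a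
modulus `q`. [cite: Regev2009, Theorem 3.1 (proof: `rᵢ = r(αp/√n)ⁱ`)] -/
def stepRatio (a : ℕ → ℚ) (q : ℕ → ℕ) (n : ℕ) : ℚ := |a n| * q n * invSqrtUp n

/-- `|q| = |num q| / den q`. [folklore] -/
theorem abs_eq_natAbs_div_den (r : ℚ) : ((|r.num| : ℤ) : ℚ) / (r.den : ℚ) = |r| := by
  conv_rhs => rw [← Rat.num_div_den r]
  rw [abs_div, Int.cast_abs, Nat.abs_cast]

/-- **The step ratio is poly-time computable** (from codes of `a` and `q` on unary `n`).
[cite: AroraBarak2009, §1.3] -/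
theorem stepRatio_codeFP {a : ℕ → ℚ} {q : ℕ → ℕ} (ha : CodeFP unE encodeRat a) (hq : CodeFP unE natE q) :
    CodeFP unE encodeRat (stepRatio a q) := by
  have hnd : CodeFP unE (pairE intE natE) (fun n => ((a n).num, (a n).den)) := (ratNumDen.comp ha :)
  have habs' : CodeFP unE encodeRat (fun n => (((|(a n).num| : ℤ) : ℚ) / ((a n).den : ℚ))) :=
    (ratOfIntNat.comp ((intAbs.comp hnd.fst').pair hnd.snd') :)
  have habs : CodeFP unE encodeRat (fun n => |a n|) := habs'.congr fun n => abs_eq_natAbs_div_den _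
  have hq' : CodeFP unE encodeRat (fun n => (((q n : ℕ) : ℤ) : ℚ) / ((1 : ℕ) : ℚ)) :=
    (ratOfIntNat.comp ((intOfNat.comp hq).pair (const unE (1 : ℕ))) :)
  have hqQ : CodeFP unE encodeRat (fun n => (q n : ℚ)) := hq'.congr fun n => by simp
  have h : CodeFP unE encodeRat (fun n => |a n| * q n * invSqrtUp n) :=
    (ratMul.comp ((ratMul.comp (habs.pair hqQ)).pair invSqrtUp_codeFP) :)
  exact h

/-- **Lower bound** `a q/√n ≤ θ(n)` for every `n ≥ 1` (no sign hypothesis on `a`). [folklore] -/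
theorem le_stepRatio (a : ℕ → ℚ) (q : ℕ → ℕ) {n : ℕ} (hn : 0 < n) :
    (a n : ℝ) * q n / Real.sqrt n ≤ ((stepRatio a q n : ℚ) : ℝ) := by
  have hU := one_div_sqrt_le_invSqrtUp hn
  have hs : 0 < Real.sqrt n := Real.sqrt_pos.2 (by exact_mod_cast hn)
  have hU0 : 0 ≤ ((invSqrtUp n : ℚ) : ℝ) := le_trans (by positivity) hU
  have hq0 : (0 : ℝ) ≤ q n := by positivity
  rw [stepRatio]; push_cast
  calc (a n : ℝ) * q n / Real.sqrt n = (a n : ℝ) * (q n * (1 / Real.sqrt n)) := by ring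
    _ ≤ |((a n : ℚ) : ℝ)| * (q n * (1 / Real.sqrt n)) :=
        mul_le_mul_of_nonneg_right (le_abs_self _) (by positivity)
    _ ≤ |((a n : ℚ) : ℝ)| * (q n * ((invSqrtUp n : ℚ) : ℝ)) :=
        mul_le_mul_of_nonneg_left (mul_le_mul_of_nonneg_left hU hq0) (abs_nonneg _)
    _ = |((a n : ℚ) : ℝ)| * q n * ((invSqrtUp n : ℚ) : ℝ) := by ring

/-- **Upper bound** `θ(n) ≤ (a q/√n)(1 + 2⁻ⁿ)` when `a n ≥ 0` (`n ≥ 1`). [folklore] -/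
theorem stepRatio_le (a : ℕ → ℚ) (q : ℕ → ℕ) {n : ℕ} (hn : 0 < n) (ha : 0 ≤ a n) :
    ((stepRatio a q n : ℚ) : ℝ) ≤ (a n : ℝ) * q n / Real.sqrt n * (1 + 1 / (2 : ℝ) ^ n) := by
  have hU := invSqrtUp_le hn
  have ha' : (0 : ℝ) ≤ ((a n : ℚ) : ℝ) := by exact_mod_cast ha
  rw [stepRatio]; push_cast
  rw [abs_of_nonneg ha']
  calc ((a n : ℚ) : ℝ) * q n * ((invSqrtUp n : ℚ) : ℝ) ≤ ((a n : ℚ) : ℝ) * q n * (1 / Real.sqrt n * (1 + 1 / (2 : ℝ) ^ n)) :=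
        mul_le_mul_of_nonneg_left hU (by positivity)
    _ = ((a n : ℚ) : ℝ) * q n / Real.sqrt n * (1 + 1 / (2 : ℝ) ^ n) := by ring

/-- **The relative slack of the step ratio is `≤ 2⁻ⁿ`**: `1 - (a q/√n)/θ(n) ≤ 1/2ⁿ` when `a n, q n > 0`
(`n ≥ 1`). [folklore] -/
theorem one_sub_div_stepRatio_le (a : ℕ → ℚ) (q : ℕ → ℕ) {n : ℕ} (hn : 0 < n) (ha : 0 < a n) (hq : 0 < q n) :
    1 - (a n : ℝ) * q n / Real.sqrt n / ((stepRatio a q n : ℚ) : ℝ) ≤ 1 / (2 : ℝ) ^ n := by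
  set θ₀ : ℝ := (a n : ℝ) * q n / Real.sqrt n with hθ₀
  have hs : 0 < Real.sqrt n := Real.sqrt_pos.2 (by exact_mod_cast hn)
  have h0 : 0 < θ₀ := by
    have : (0 : ℝ) < ((a n : ℚ) : ℝ) := by exact_mod_cast ha
    have : (0 : ℝ) < q n := by exact_mod_cast hq
    positivity
  have hle : θ₀ ≤ ((stepRatio a q n : ℚ) : ℝ) := le_stepRatio a q hn
  have hθ : 0 < ((stepRatio a q n : ℚ) : ℝ) := h0.trans_le hle
  have hup : ((stepRatio a q n : ℚ) : ℝ) ≤ θ₀ * (1 + 1 / (2 : ℝ) ^ n) := stepRatio_le a q hn ha.le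
  have hK : (0 : ℝ) < (2 : ℝ) ^ n := by positivity
  rw [sub_le_iff_le_add, ← sub_le_iff_le_add', le_div_iff₀ hθ]
  have h1 : (1 - 1 / (2 : ℝ) ^ n) * (θ₀ * (1 + 1 / (2 : ℝ) ^ n)) ≤ θ₀ := by
    have : (1 - 1 / (2 : ℝ) ^ n) * (1 + 1 / (2 : ℝ) ^ n) = 1 - 1 / ((2 : ℝ) ^ n) ^ 2 := by ring
    calc (1 - 1 / (2 : ℝ) ^ n) * (θ₀ * (1 + 1 / (2 : ℝ) ^ n)) = θ₀ * (1 - 1 / ((2 : ℝ) ^ n) ^ 2) := by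
          rw [← this]; ring
      _ ≤ θ₀ * 1 := mul_le_mul_of_nonneg_left (by
          have : 0 ≤ 1 / ((2 : ℝ) ^ n) ^ 2 := by positivity
          linarith) h0.le
      _ = θ₀ := mul_one _
  have h2 : 0 ≤ 1 - 1 / (2 : ℝ) ^ n := by
    rw [sub_nonneg, div_le_one hK]; exact one_le_pow₀ (by norm_num)
  calc (1 - 1 / (2 : ℝ) ^ n) * ((stepRatio a q n : ℚ) : ℝ) ≤ (1 - 1 / (2 : ℝ) ^ n) * (θ₀ * (1 + 1 / (2 : ℝ) ^ n)) :=
      mul_le_mul_of_nonneg_left hup h2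
    _ ≤ θ₀ := h1

/-- **The `∃ θ` of A_step, witnessed**: under `IsPolyTimeParams q α m` there is a poly-time computable
rational `θ` with `α q/√n ≤ θ(n)` for all `n ≥ 1` and `θ(n) ≤ (α q/√n)(1 + 2⁻ⁿ)` whenever `α n ≥ 0`.
[cite: Regev2009, Theorem 3.1 (proof); AroraBarak2009, §1.3] -/
theorem exists_polyTime_stepRatio {q : ℕ → ℕ} {α : ℕ → ℝ} {m : ℕ → ℕ} (hP : IsPolyTimeParams q α m) :
    ∃ θ : ℕ → ℚ, PolyTimeComputable unaryEncodeNat encodeRat θ ∧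
      (∀ n, 0 < n → α n * q n / Real.sqrt n ≤ θ n) ∧
      ∀ n, 0 < n → 0 ≤ α n → (θ n : ℝ) ≤ α n * q n / Real.sqrt n * (1 + 1 / (2 : ℝ) ^ n) := by
  obtain ⟨hq, -, a, hαa, ha⟩ := hP
  refine ⟨stepRatio a q, (stepRatio_codeFP (ofPolyTimeComputable_unE ha) (codeFP_natParam hq)).polyTimeComputable,
    fun n hn => ?_, fun n hn hα => ?_⟩
  · rw [hαa n]; exact le_stepRatio a q hn
  · have ha0 : 0 ≤ a n := by have := hαa n; exact_mod_cast this ▸ hα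
    rw [hαa n]; exact stepRatio_le a q hn ha0

/-! ### Absorbing the slack: nearby widths -/

/-- **`Δ(D_{L,R/θ₀}, D_{L,R/θ}) ≤ n(1 - θ₀/θ)`** for `0 < θ₀ ≤ θ`, `R > 0`, read in integer coordinates
(the tree's `tvDist_discreteGaussian_le_mul_one_sub_div`). [cite: Regev2009, Lemma 2.4] -/
theorem tvDist_map_intCoords_discreteGaussian_div_le {I : LatticeInstance} (hI : I.IsNonsingular)
    {θ₀ θ R : ℝ} (h0 : 0 < θ₀) (hle : θ₀ ≤ θ) (hR : 0 < R) :
    ((discreteGaussian I.lattice (R / θ₀) 0).map I.intCoords).tvDist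
        ((discreteGaussian I.lattice (R / θ) 0).map I.intCoords) ≤ I.n * (1 - θ₀ / θ) := by
  haveI := LatticeInstance.isZLattice_of_isNonsingular hI
  have hθ : 0 < θ := h0.trans_le hle
  have hs : 0 < R / θ := div_pos hR hθ
  have hss' : R / θ ≤ R / θ₀ := div_le_div_of_nonneg_left hR.le h0 hle
  refine (PMF.tvDist_map_le_holds _ _ _).trans ?_
  have h := tvDist_discreteGaussian_le_mul_one_sub_div I.lattice hs hss'
  rw [finrank_euclideanSpace_fin] at h
  have heq : R / θ / (R / θ₀) = θ₀ / θ := by field_simp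
  rw [heq] at h
  exact h

/-- `ρ_{k+1} = ρ_k/θ` for `k < L`, `θ ≠ 0`. [cite: Regev2009, Theorem 3.1 (proof)] -/
theorem levelRadius_succ {θ : ℝ} (hθ : θ ≠ 0) {L k : ℕ} (hk : k < L) (r : ℝ) :
    levelRadius θ L r (k + 1) = levelRadius θ L r k / θ := by
  unfold levelRadius
  rw [show L - k = (L - (k + 1)) + 1 by omega, pow_succ]
  field_simp

/-- **Regev's exact step output meets A_step's target up to `n/2ⁿ` (answer to F-5.1).** With
`θ = stepRatio a q` (`α = a` rational, `α n, q n > 0`), at every stage `k < 3n` of the ladder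
`ρ_k = θ^{3n-k} r` with `ρ_k > 0`: the law `D_{L(I), ρ_k√n/(α q)}` that Lemma 3.3 produces EXACTLY from
samples of `D_{L(I),ρ_k}` (Lemma 3.4 at decoding distance `αq/(√2ρ_k)`, Lemma 3.14) is within statistical
distance `n/2ⁿ` of `D_{L(I),ρ_{k+1}}`, both read in integer coordinates. Hence a machine for Lemma 3.3
whose per-batch error against `D_{L,ρ_k√n/(αq)}` is `F₁(b)` satisfies STEP₁ of
`regev2009_lemma_3_3_stepMachine` with `F₁(b) + n/2ⁿ`: no radius below Regev's is ever sampled.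
[cite: Regev2009, Lemma 3.3 (p. 15) with Lemmas 3.4, 3.14, Lemma 2.4] -/
theorem tvDist_regevStep_levelRadius_le (a : ℕ → ℚ) (q : ℕ → ℕ) {I : LatticeInstance} (hI : I.IsNonsingular)
    (hn : 0 < I.n) (ha : 0 < a I.n) (hq : 0 < q I.n) {r : ℝ} {k : ℕ} (hk : k < 3 * I.n)
    (hR : 0 < levelRadius (stepRatio a q I.n : ℝ) (3 * I.n) r k) :
    ((discreteGaussian I.lattice
        (levelRadius (stepRatio a q I.n : ℝ) (3 * I.n) r k * Real.sqrt I.n / (a I.n * q I.n)) 0).map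
          I.intCoords).tvDist
      ((discreteGaussian I.lattice (levelRadius (stepRatio a q I.n : ℝ) (3 * I.n) r (k + 1)) 0).map
          I.intCoords) ≤ I.n / (2 : ℝ) ^ I.n := by
  set θ : ℝ := ((stepRatio a q I.n : ℚ) : ℝ) with hθ_def
  set θ₀ : ℝ := (a I.n : ℝ) * q I.n / Real.sqrt I.n with hθ₀
  have hs : 0 < Real.sqrt I.n := Real.sqrt_pos.2 (by exact_mod_cast hn)
  have ha' : (0 : ℝ) < ((a I.n : ℚ) : ℝ) := by exact_mod_cast ha
  have hq' : (0 : ℝ) < q I.n := by exact_mod_cast hq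
  have h0 : 0 < θ₀ := by positivity
  have hle : θ₀ ≤ θ := le_stepRatio a q hn
  have hθ : 0 < θ := h0.trans_le hle
  set R : ℝ := levelRadius θ (3 * I.n) r k with hR_def
  have h1 : R * Real.sqrt I.n / (a I.n * q I.n) = R / θ₀ := by
    rw [hθ₀]; field_simp
  rw [h1, levelRadius_succ hθ.ne' hk]
  refine (tvDist_map_intCoords_discreteGaussian_div_le hI h0 hle hR).trans ?_
  have h2 := one_sub_div_stepRatio_le a q hn ha hq
  calc (I.n : ℝ) * (1 - θ₀ / θ) ≤ I.n * (1 / (2 : ℝ) ^ I.n) := mul_le_mul_of_nonneg_left h2 (by positivity)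
    _ = I.n / (2 : ℝ) ^ I.n := by ring

/-! ### Absorbing the slack: the averaged error -/

/-- **A uniform additive slack `δ ≥ 0` in the per-batch error moves the averaged error by at most `δ`**:
`Σ_b p(b)·min(1, F b + δ) ≤ Σ_b p(b)·min(1, F b) + δ` for a probability mass function `p` and `F ≥ 0`.
[folklore] -/
theorem tsum_mul_min_one_add_le {β : Type*} (p : PMF β) {F : β → ℝ} (hF : ∀ b, 0 ≤ F b) {δ : ℝ} (hδ : 0 ≤ δ) :
    ∑' b, (p b).toReal * min 1 (F b + δ) ≤ (∑' b, (p b).toReal * min 1 (F b)) + δ := by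
  have hp : ∀ b, 0 ≤ (p b).toReal := fun b => ENNReal.toReal_nonneg
  have hsum1 : Summable fun b => (p b).toReal := by
    exact ENNReal.summable_toReal (by rw [p.tsum_coe]; exact ENNReal.one_ne_top)
  have htot : ∑' b, (p b).toReal = 1 := by
    rw [← ENNReal.tsum_toReal_eq (fun b => p.apply_ne_top b), p.tsum_coe, ENNReal.toReal_one]
  have hle1 : ∀ (G : β → ℝ), (∀ b, 0 ≤ G b) → Summable fun b => (p b).toReal * min 1 (G b) := by
    intro G hG
    refine Summable.of_nonneg_of_le (fun b => mul_nonneg (hp b) (le_min zero_le_one (hG b)))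
      (fun b => ?_) hsum1
    calc (p b).toReal * min 1 (G b) ≤ (p b).toReal * 1 :=
        mul_le_mul_of_nonneg_left (min_le_left _ _) (hp b)
      _ = (p b).toReal := mul_one _
  have hS : Summable fun b => (p b).toReal * min 1 (F b) := hle1 F hF
  have hSδ : Summable fun b => (p b).toReal * min 1 (F b + δ) := hle1 _ fun b => add_nonneg (hF b) hδ
  have hpt : ∀ b, (p b).toReal * min 1 (F b + δ) ≤ (p b).toReal * min 1 (F b) + (p b).toReal * δ := by
    intro b
    rw [← mul_add]
    refine mul_le_mul_of_nonneg_left ?_ (hp b)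
    rcases le_total 1 (F b) with h | h
    · rw [min_eq_left h, min_eq_left (by linarith)]; linarith
    · rw [min_eq_right h]; exact (min_le_right _ _).trans le_rfl
  calc ∑' b, (p b).toReal * min 1 (F b + δ) ≤ ∑' b, ((p b).toReal * min 1 (F b) + (p b).toReal * δ) :=
      Summable.tsum_le_tsum hpt hSδ (hS.add (hsum1.mul_right δ))
    _ = (∑' b, (p b).toReal * min 1 (F b)) + ∑' b, (p b).toReal * δ := hS.tsum_add (hsum1.mul_right δ)
    _ = (∑' b, (p b).toReal * min 1 (F b)) + δ := by rw [tsum_mul_right, htot, one_mul]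

/-- `n/2ⁿ` is negligible. [folklore] -/
theorem isNegligible_nat_div_two_pow : IsNegligible fun n : ℕ => (n : ℝ) / (2 : ℝ) ^ n := by
  have h := isNegligible_two_inv_pow.polynomial_mul (Polynomial.X : Polynomial ℝ)
  have he : (fun n : ℕ => Polynomial.eval (n : ℝ) (Polynomial.X : Polynomial ℝ) * (2⁻¹ : ℝ) ^ n) =
      fun n : ℕ => (n : ℝ) / (2 : ℝ) ^ n := by
    funext n; simp [div_eq_mul_inv]
  rw [he] at h
  exact h

end Regev2009

/-! ### A_step is Lemma 3.3 at Regev's exact radius, on the `stepRatio` ladder -/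

section Exact

variable (q : ℕ → ℕ) [∀ n, NeZero (q n)] (α : ℕ → ℝ)

/-- NAMED FACT (residual A_exact) — **Regev 2009, Lemma 3.3 in machine form with its EXACT output radius.**
Word for word the residual `regev2009_lemma_3_3_stepMachine q α` (A_step) except in two places: the ladder
ratio is not existentially chosen but FIXED to `θ = Regev2009.stepRatio a q` for the rational presentation
`a` of `α` (`α = a`, `a` poly-time — supplied by `IsPolyTimeParams`), and clause (STEP₁) at a stage `k + 1 ≤ 3n`
with input radius `ρ_k = θ(n)^{3n-k} r > √2 q η_ε(L(I))` asks the copies to be `F₁(b)`-close to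
`D_{L(I), ρ_k √n/(α q)}` — the distribution Lemma 3.3 produces ("given … `r > √2 q η_ε(L)` and `n^c` samples
from `D_{L,r}`, produces a sample from `D_{L, r√n/(αq)}`", p. 15, via Lemma 3.4 at decoding distance
`αq/(√2 r)` and Lemma 3.14), NOT to `D_{L(I),ρ_{k+1}}`. `regev2009_lemma_3_3_stepMachine_of_exact` derives
A_step from it (the `n/2ⁿ` gap is absorbed into `ν₁`). Users take `(hE : regev2009_lemma_3_3_stepExact q α)`.
[cite: Regev2009, Lemma 3.3 (p. 15) and the note following it, with Lemmas 3.4, 3.14] -/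
def regev2009_lemma_3_3_stepExact : Prop :=
  ∀ (m : ℕ → ℕ) (_ : IsPolyBounded m) (_ : IsPolyTimeParams q α m)
    (_ : ∀ᶠ n : ℕ in atTop, 0 < α n ∧ α n < 1 ∧ 2 * Real.sqrt n < α n * q n)
    (_ : ∃ (W : UniformQCircuitFamily) (c : ℝ), 0 < c ∧
      W.SolvesSearchLWEWorstCase q (fun n => discretizedGaussian (q n) (α n)) m
        fun n => (2 : ℝ) ^ (-(c * n)))
    (ε : ℕ → ℝ), IsNegligible ε → (∀ n, 0 < ε n) →
    ∀ (a : ℕ → ℚ), (∀ n, α n = a n) → PolyTimeComputable unaryEncodeNat encodeRat a →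
      ∀ Lreq : Polynomial ℕ, ∃ (Q : UniformQCircuitFamily) (pN L : Polynomial ℕ) (ν₁ : ℕ → ℝ),
        IsNegligible ν₁ ∧ (∀ n, 0 < pN.eval n) ∧ (∀ t, Lreq.eval t ≤ L.eval t) ∧
        ∀ᶠ n : ℕ in atTop, ∀ (I : LatticeInstance) (r : ℚ) (x : List Bool), I.n = n → I.IsNonsingular →
          x = GapSVPInstance.encode (I, r) →
          (∀ (k : ℕ) (y : List Bool) (j : ℕ) (s : List Bool),
            s ∈ (Q.kernel (boolPair (stageInput x (k + 1) y)
              (Regev2009.StageCopies.idxWord (Regev2009.StageCopies.KOf pN x (k + 1) y) j))).support →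
            boolPair (Regev2009.vecCode I.n (decodeLatticeVector I.n s)) [] <+: s ∧
              (Regev2009.vecCode I.n (decodeLatticeVector I.n s)).length ≤ L.eval x.length) ∧
          (∀ k, k < 3 * I.n →
            Real.sqrt 2 * q I.n * smoothingParameter I.lattice (ε I.n) <
                Regev2009.levelRadius (Regev2009.stepRatio a q I.n) (3 * I.n) r k →
            ∃ F₁ : (Fin (pN.eval I.n) → Fin I.n → ℤ) → ℝ, (∀ b, 0 ≤ F₁ b) ∧
              (∀ b : Fin (pN.eval I.n) → Fin I.n → ℤ,
                (∀ j, (Regev2009.vecCode I.n (b j)).length ≤ L.eval x.length) →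
                ∀ (pad : List Bool) (j : ℕ), j < pN.eval I.n →
                  ((Q.kernel (boolPair (stageInput x (k + 1) (Regev2009.encBatch I.n (pN.eval I.n) b ++ pad))
                      (Regev2009.StageCopies.idxWord (Regev2009.StageCopies.KOf pN x (k + 1)
                        (Regev2009.encBatch I.n (pN.eval I.n) b ++ pad)) j))).map
                      (decodeLatticeVector I.n)).tvDist
                    ((discreteGaussian I.lattice
                        (Regev2009.levelRadius (Regev2009.stepRatio a q I.n) (3 * I.n) r k * Real.sqrt I.n /
                          (α I.n * q I.n)) 0).map
                      I.intCoords) ≤ F₁ b) ∧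
              ∑' b, (Regev2009.idealBatchZ I (pN.eval I.n)
                    (Regev2009.levelRadius (Regev2009.stepRatio a q I.n) (3 * I.n) r k) b).toReal *
                  min 1 (F₁ b) ≤ ν₁ I.n) ∧
          (∀ k, 3 * I.n ≤ k → ∀ b : Fin (pN.eval I.n) → Fin I.n → ℤ,
            (∀ j, (Regev2009.vecCode I.n (b j)).length ≤ L.eval x.length) →
            ∀ (pad : List Bool) (j : ℕ) (hj : j < pN.eval I.n),
              (Q.kernel (boolPair (stageInput x (k + 1) (Regev2009.encBatch I.n (pN.eval I.n) b ++ pad))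
                  (Regev2009.StageCopies.idxWord (Regev2009.StageCopies.KOf pN x (k + 1)
                    (Regev2009.encBatch I.n (pN.eval I.n) b ++ pad)) j))).map
                  (decodeLatticeVector I.n) = PMF.pure (b ⟨j, hj⟩))

/-- **A_step follows from Lemma 3.3 at Regev's exact radius (answer to F-5.1).** Take
`θ = Regev2009.stepRatio a q` (poly-time, `α q/√n ≤ θ ≤ (α q/√n)(1 + 2⁻ⁿ)`); at a stage `k < 3n` with
`ρ_k > √2 q η_ε > 0`, the exact output `D_{L,ρ_k√n/(αq)}` is `n/2ⁿ`-close to `D_{L,ρ_{k+1}}`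
(`Regev2009.tvDist_regevStep_levelRadius_le`), so `F₁ + n/2ⁿ` and `ν₁ + n/2ⁿ` witness (STEP₁) of A_step;
(CODE⁺) and (PASS₁) are copied. No decoding distance beyond Lemma 3.4's `αq/(√2ρ_k)` is involved.
[cite: Regev2009, Lemma 3.3 (p. 15) with Lemmas 3.4, 3.14, Lemma 2.4] -/
theorem regev2009_lemma_3_3_stepMachine_of_exact (hE : regev2009_lemma_3_3_stepExact q α) :
    regev2009_lemma_3_3_stepMachine q α := by
  intro m hm hP hreg hW ε hε hεpos
  obtain ⟨hq, hmP, a, hαa, hac⟩ := hP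
  refine ⟨Regev2009.stepRatio a q,
    (Regev2009.stepRatio_codeFP (ofPolyTimeComputable_unE hac) (codeFP_natParam hq)).polyTimeComputable,
    fun n hn => ?_, fun Lreq => ?_⟩
  · rw [hαa n]; exact Regev2009.le_stepRatio a q hn
  obtain ⟨Q, pN, L, ν₁, hν, hpN, hL, hev⟩ := hE m hm ⟨hq, hmP, a, hαa, hac⟩ hreg hW ε hε hεpos a hαa hac Lreq
  refine ⟨Q, pN, L, fun n => ν₁ n + (n : ℝ) / (2 : ℝ) ^ n, hν.add Regev2009.isNegligible_nat_div_two_pow,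
    hpN, hL, ?_⟩
  filter_upwards [hev, hreg, eventually_gt_atTop 0] with n hn hregn hn0
  intro I r x hIn hI hx
  obtain ⟨hcode, hstep, hpass⟩ := hn I r x hIn hI hx
  refine ⟨hcode, fun k hk hsm => ?_, hpass⟩
  obtain ⟨F₁, hF0, hF, havg⟩ := hstep k hk hsm
  obtain ⟨hα0, -, h2⟩ := hregn
  have hnI : 0 < I.n := by rw [hIn]; exact hn0
  have ha : 0 < a I.n := by
    have : (0 : ℝ) < ((a n : ℚ) : ℝ) := by rw [← hαa n]; exact hα0
    rw [hIn]; exact_mod_cast this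
  have hqpos : 0 < q I.n := by
    have hαq : (0 : ℝ) < α n * q n := lt_of_le_of_lt (by positivity) h2
    have hqr : (0 : ℝ) < q n := (mul_pos_iff_of_pos_left hα0).1 hαq
    rw [hIn]; exact_mod_cast hqr
  have hR : 0 < Regev2009.levelRadius (Regev2009.stepRatio a q I.n : ℝ) (3 * I.n) r k :=
    lt_of_le_of_lt (mul_nonneg (mul_nonneg (Real.sqrt_nonneg _) (Nat.cast_nonneg _))
      (smoothingParameter_nonneg _ _)) hsm
  refine ⟨fun b => F₁ b + (I.n : ℝ) / (2 : ℝ) ^ I.n, fun b => add_nonneg (hF0 b) (by positivity),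
    fun b hb pad j hj => ?_, ?_⟩
  · have h1 := hF b hb pad j hj
    rw [hαa I.n] at h1
    exact (PMF.tvDist_triangle_holds _ _ _).trans
      (add_le_add h1 (Regev2009.tvDist_regevStep_levelRadius_le a q hI hnI ha hqpos hk hR))
  · calc ∑' b, (Regev2009.idealBatchZ I (pN.eval I.n)
              (Regev2009.levelRadius (Regev2009.stepRatio a q I.n) (3 * I.n) r k) b).toReal *
            min 1 (F₁ b + (I.n : ℝ) / (2 : ℝ) ^ I.n)
          ≤ (∑' b, (Regev2009.idealBatchZ I (pN.eval I.n)
              (Regev2009.levelRadius (Regev2009.stepRatio a q I.n) (3 * I.n) r k) b).toReal *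
            min 1 (F₁ b)) + (I.n : ℝ) / (2 : ℝ) ^ I.n :=
          Regev2009.tsum_mul_min_one_add_le _ hF0 (by positivity)
      _ ≤ ν₁ I.n + (I.n : ℝ) / (2 : ℝ) ^ I.n := add_le_add havg le_rfl

/-- **Corollary: Regev's quantum `LWE → SIVP` reduction from A_exact alone.** [cite: Regev2009, Theorem 1.1
via Theorem 3.1, Lemmas 3.2, 3.3, 3.17] -/
theorem regev_lwe_to_sivp_quantum_holds_of_exact (m : ℕ → ℕ) (hE : regev2009_lemma_3_3_stepExact q α) :
    regev_lwe_to_sivp_quantum q α m :=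
  regev_lwe_to_sivp_quantum_holds_of_step q α m (regev2009_lemma_3_3_stepMachine_of_exact q α hE)

/-- **Corollary: Regev's quantum `LWE → GapSVP` reduction from A_exact alone.** [cite: Regev2009, Theorem 1.1
via Theorem 3.1, Lemmas 3.2, 3.3, 3.20] -/
theorem regev_lwe_to_gapSVP_quantum_holds_of_exact (m : ℕ → ℕ) (hE : regev2009_lemma_3_3_stepExact q α) :
    regev_lwe_to_gapSVP_quantum q α m :=
  regev_lwe_to_gapSVP_quantum_holds_of_step q α m (regev2009_lemma_3_3_stepMachine_of_exact q α hE)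

end Exact

end Literature.Computability.Cryptography
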